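import Literature.Probability.RandomPlanarGeometry.HexSAWPolygonCellsBaseDataRU
import Literature.Probability.RandomPlanarGeometry.HexSAWPolygonCellsBaseDataXR
import Literature.Probability.RandomPlanarGeometry.HexSAWPolygonCellsPeelPolygon
import HarnessLib

/-!
# Cell calculus for honeycomb polygon surgery, XXIX: the RU-family images have polygonal boundaries

Topic `Literature/Probability/RandomPlanarGeometry` (lane «pcv-sawmu», a-p4 g22; sequel of XXVIII `…CellsBaseDataRU` (images), XXIII `…CellsBaseDataXR`
(`isPolygon_bdry_union_roof`), XXIV `…CellsPeelPolygon` (`isPolygon_bdry_erase_of_isSpikeTop`), XIX `…CellsPolygonMoves`).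

For the roof-end base `B = B₀ + a_k` with `bdry B` a honeycomb polygon: ★ `isPolygon_bdry_ruFlipImage` (insert `UL c_j` with contact arc `{L c_j, c_j}`) and
★ `isPolygon_bdry_ruLeafImage` (peel the spike `a_k`, re-grow the whole roof `a_1 … a_k` on `B₀`, insert `UL c_j` with the single contact `c_j`).  With XXVIII
this completes the three inputs of XXII's THEOREM V for the RU-family.

Sources: N. Madras, G. Slade, *The Self-Avoiding Walk* (1993), §3.2, proof of Theorem 3.2.3 pp. 64–65 [MadrasSlade1993]; I. Jensen, J. Phys.: Conf. Ser. 42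
(2006) 163 [Jensen2006HoneycombPolygons].  Label (lane): LANE INFRASTRUCTURE; nothing new in writing.
-/

open Finset

namespace Literature.Probability.RandomPlanarGeometry.SAW

namespace HexCell

variable {B₀ : Finset Cell} {t₀ : Cell} {k : ℕ}

/-- A type-R set has perimeter `≥ 4` (the top hexagon has `UR, UL, R, L` free). [cite: MadrasSlade1993, §3.2 (proof of Theorem 3.2.3)] -/
theorem four_le_perim_of_typeR (ht : IsLexmax B₀ t₀) (hL : L t₀ ∉ B₀) : 4 ≤ perim B₀ := by
  have hsub : ({UR t₀, UL t₀, R t₀, L t₀} : Finset Cell) ⊆ nbrs t₀ \ B₀ := by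
    intro x hx
    simp only [mem_insert, mem_singleton] at hx
    rw [mem_sdiff, mem_nbrs_iff]
    obtain ⟨a, b⟩ := t₀
    rcases hx with rfl | rfl | rfl | rfl
    · exact ⟨by simp [UR], ht.ur_notMem⟩
    · exact ⟨by simp [UL], ht.ul_notMem⟩
    · exact ⟨by simp [R], ht.r_notMem⟩
    · exact ⟨by simp [L], hL⟩
  have h4 : #({UR t₀, UL t₀, R t₀, L t₀} : Finset Cell) = 4 := by
    obtain ⟨a, b⟩ := t₀
    rw [card_insert_of_notMem (by simp [UR, UL, R, L, Prod.ext_iff]; omega), card_insert_of_notMem (by simp [UL, R, L, Prod.ext_iff]),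
      card_pair (by simp [R, L, Prod.ext_iff]; omega)]
  calc 4 = #({UR t₀, UL t₀, R t₀, L t₀} : Finset Cell) := h4.symm
    _ ≤ #(nbrs t₀ \ B₀) := card_le_card hsub
    _ ≤ perim B₀ := by
        rw [perim]; exact Finset.single_le_sum (f := fun c => #(nbrs c \ B₀)) (fun _ _ => Nat.zero_le _) ht.1

/-- ★ **The RU flip image has a polygonal boundary** when `B` has. [cite: MadrasSlade1993, §3.2, proof of Theorem 3.2.3 pp. 64–65] -/
theorem isPolygon_bdry_ruFlipImage (hB : IsBrickSet B₀) (ht : IsLexmax B₀ t₀) (hk : 2 ≤ k) (hrun : ∀ i < k, runCell t₀ i ∈ B₀) (hend : runCell t₀ k ∉ B₀)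
    (hflip : L (chainCell t₀ (chainIdx B₀ t₀)) ∈ B₀) (hP : IsPolygon brickWallGraph (bdry (insert (roofCell t₀ (k - 1)) B₀))) :
    IsPolygon brickWallGraph (bdry (ruFlipImage B₀ t₀ k)) := by
  have hBb := isBrickSet_roofEnd (k := k) hB ht
  have hcB : chainCell t₀ (chainIdx B₀ t₀) ∈ B₀ := chainCell_mem ht.1 le_rfl
  have hcb := hB _ hcB
  have hsp := isSpikeTop_roofEnd ht hk hrun hend
  have h7 := seven_le_perim_of_isSpikeTop hsp
  -- rows of `B` are `≤ t₀.y = c.y`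
  have hW : ∀ d ∈ insert (roofCell t₀ (k - 1)) B₀, d.2 ≤ (chainCell t₀ (chainIdx B₀ t₀)).2 := by
    intro d hd
    rcases mem_insert.1 hd with rfl | hd
    · simp
    · rcases ht.2 d hd with h | ⟨h, -⟩ <;> simp <;> omega
  obtain ⟨hnot, -⟩ := card_contacts_ul_topRow_two hW (mem_insert_of_mem hcB) (mem_insert_of_mem hflip)
  refine isPolygon_bdry_insert hBb (by rw [Int.even_iff] at hcb ⊢; simp only [UL_fst, UL_snd, chainCell_fst, chainCell_snd] at hcb ⊢; omega) hnot hP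
    (a := 0) (m := 2) (by norm_num) (by norm_num) (by omega) ?_
  have hsub := contacts_ul_subset_of_rows_le hW
  intro i hi
  interval_cases i
  · rw [show nbrDir (UL (chainCell t₀ (chainIdx B₀ t₀))) (0 + 0) = LL (UL (chainCell t₀ (chainIdx B₀ t₀))) from rfl]
    simp only [Nat.zero_lt_two, iff_true]
    rw [show LL (UL (chainCell t₀ (chainIdx B₀ t₀))) = L (chainCell t₀ (chainIdx B₀ t₀)) by ext <;> simp; ring]
    exact mem_insert_of_mem hflip
  · rw [show nbrDir (UL (chainCell t₀ (chainIdx B₀ t₀))) (0 + 1) = LR (UL (chainCell t₀ (chainIdx B₀ t₀))) from rfl]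
    simp only [Nat.one_lt_two, iff_true]
    rw [show LR (UL (chainCell t₀ (chainIdx B₀ t₀))) = chainCell t₀ (chainIdx B₀ t₀) by ext <;> simp]
    exact mem_insert_of_mem hcB
  all_goals
    simp only [show ¬ ((2:ℕ) < 2) by norm_num, show ¬ ((3:ℕ) < 2) by norm_num, show ¬ ((4:ℕ) < 2) by norm_num, show ¬ ((5:ℕ) < 2) by norm_num,
      iff_false]
    intro hm
    have := hsub (mem_inter.2 ⟨nbrDir_mem_nbrs _ _, hm⟩)
    simp only [mem_insert, mem_singleton] at this
    rcases this with e | e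
    · have := nbrDir_injective_mod (e.trans (show L (chainCell t₀ (chainIdx B₀ t₀)) = nbrDir (UL (chainCell t₀ (chainIdx B₀ t₀))) 0 by
        rw [show nbrDir (UL (chainCell t₀ (chainIdx B₀ t₀))) 0 = LL (UL (chainCell t₀ (chainIdx B₀ t₀))) from rfl]; ext <;> simp; ring))
      omega
    · have := nbrDir_injective_mod (e.trans (show chainCell t₀ (chainIdx B₀ t₀) = nbrDir (UL (chainCell t₀ (chainIdx B₀ t₀))) 1 by
        rw [show nbrDir (UL (chainCell t₀ (chainIdx B₀ t₀))) 1 = LR (UL (chainCell t₀ (chainIdx B₀ t₀))) from rfl]; ext <;> simp))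
      omega

/-- ★ **The RU leaf image has a polygonal boundary** when `B` has. [cite: MadrasSlade1993, §3.2, proof of Theorem 3.2.3 pp. 64–65] -/
theorem isPolygon_bdry_ruLeafImage (hB : IsBrickSet B₀) (ht : IsLexmax B₀ t₀) (hL : L t₀ ∉ B₀) (hk : 2 ≤ k) (hrun : ∀ i < k, runCell t₀ i ∈ B₀)
    (hend : runCell t₀ k ∉ B₀) (hleaf : L (chainCell t₀ (chainIdx B₀ t₀)) ∉ B₀)
    (hP : IsPolygon brickWallGraph (bdry (insert (roofCell t₀ (k - 1)) B₀))) :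
    IsPolygon brickWallGraph (bdry (ruLeafImage B₀ t₀ k)) := by
  classical
  have hBb := isBrickSet_roofEnd (k := k) hB ht
  have hcB : chainCell t₀ (chainIdx B₀ t₀) ∈ B₀ := chainCell_mem ht.1 le_rfl
  have hcb := hB _ hcB
  -- peel the spike: `bdry B₀` is a polygon
  have hsp := isSpikeTop_roofEnd ht hk hrun hend
  have h0 : IsPolygon brickWallGraph (bdry B₀) := by
    have := isPolygon_bdry_erase_of_isSpikeTop hBb hsp hP
    rwa [erase_insert (ht.roofCell_notMem _)] at this
  -- re-grow the whole roof
  have h1 : IsPolygon brickWallGraph (bdry (B₀ ∪ roof t₀ k)) :=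
    isPolygon_bdry_union_roof hB ht hrun hend h0 (four_le_perim_of_typeR ht hL) k le_rfl
  -- insert `UL c_j` with the single contact `c_j`
  have hW : ∀ d ∈ B₀ ∪ roof t₀ k, d.2 ≤ (chainCell t₀ (chainIdx B₀ t₀)).2 := by
    rw [chainCell_snd]; exact rows_le_union_roof ht k
  have hL' : L (chainCell t₀ (chainIdx B₀ t₀)) ∉ B₀ ∪ roof t₀ k := by
    rw [mem_union, not_or]
    refine ⟨hleaf, fun hm => ?_⟩
    obtain ⟨i, -, ei⟩ := mem_roof.1 hm
    have := congrArg Prod.fst ei; simp at this; omega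
  obtain ⟨hnot, hone⟩ := card_contacts_ul_topRow_one hW (mem_union_left _ hcB) hL'
  have hWb : IsBrickSet (B₀ ∪ roof t₀ k) := by
    intro x hx
    rcases mem_union.1 hx with hx | hx
    · exact hB x hx
    · obtain ⟨i, -, rfl⟩ := mem_roof.1 hx
      have := hB _ ht.1; rw [Int.even_iff] at this ⊢; simp; omega
  have hlt : 1 < perim (B₀ ∪ roof t₀ k) := by
    rw [← card_bdry hWb]; have := three_le_card_of_isPolygon h1; omega
  obtain ⟨a, harc⟩ := exists_arc_of_card_contacts_eq_one hone
  exact isPolygon_bdry_insert hWb (by rw [Int.even_iff] at hcb ⊢; simp only [UL_fst, UL_snd, chainCell_fst, chainCell_snd] at hcb ⊢; omega)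
    hnot h1 le_rfl (by norm_num) hlt harc

end HexCell

end Literature.Probability.RandomPlanarGeometry.SAW
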